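import Summits.Ventures.CertifiedManyBodySolver.Downfold.EmeryChargeTransferLipschitz
import Summits.Ventures.CertifiedManyBodySolver.Downfold.EmeryFermiSurfaceDoping
import HarnessLib

/-!
# THE CHARGE-TRANSFER LEVER OF THE FERMI-SURFACE SHAPE AT FIXED DOPING: a larger `Δ` makes the one-band `t′/t` of the σ row LESS
# negative — monotone, certificate-free, from the 1-Lipschitz Fermi energy

Venture CertifiedManyBodySolver, cell `pub/hubbard-downfold` (stage S1; INFLATION-RULES-3to1-B §B.83 (g)), seat hubbard-downfold-mod-4 (technique B,
g34); namespace `Summit.Ventures.CertifiedManyBodySolver.Downfold.Emery`. Everything PROVED (0 sorry, no definition). WHAT THIS IS NOT: a statement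
about any material; `U = 0` one-body kinematics of the σ (d–p_x–p_y + t_pp, t_pp′) model; no number lives here.

THE QUESTION (INFL-3to1-B for object E). By the contour theorem (`EmeryFermiSurfaceShape`, §B.13) the Fermi surface of a σ row IS a `t–t′` one-band
Fermi surface with `t′/t = fsRatio(Δ; ε_F) = −N/(D + 2N)`, `D = fsD = (Δ + ε)(t_pd² − t_pp′ε)`, `N = fsN = 2t_pd²(t_pp + t_pp′) + ε(t_pp² − t_pp′²)`.
Typed constructions of ONE material differ mostly in `Δ` (La₂CuO₄: 2.6 … 3.7 eV); the census certifies `t′/t` row by row. How does the shape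
at FIXED DOPING move with `Δ`? Two effects compete in no obvious way: `D` grows with `Δ` explicitly, and the Fermi energy of the doping moves.

* §1 `negRatio_mono`: `−N/(D + 2N)` is non-decreasing under `D ↑`, `N ↓` (`N, N′ > 0`, `D, D′ ≥ 0`).
* §2 **THE LEVER** (`fsRatio_fermiEnergyOf_mono_Delta`): for `δ ≥ 0`, `Δ > 0`, `t_pd ≠ 0`, `t_pp > 0`, `0 ≤ t_pp′ ≤ t_pp`, a filling `0 < ν < 1`
  attained at both rows and `t_pp′·ε_F(Δ; ν) ≤ t_pd²` (the sheet regime, every typed row):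
  **`fsRatio(Δ; ε_F(Δ; ν)) ≤ fsRatio(Δ + δ; ε_F(Δ + δ; ν))`** — at fixed doping, RAISING THE CHARGE-TRANSFER ENERGY MAKES `t′/t` LESS NEGATIVE.
  Mechanism (no calculus): `ε_F(Δ + δ) ∈ [ε_F(Δ) − δ, ε_F(Δ)]` (`EmeryChargeTransferLipschitz`), so `D` does not decrease
  (`Δ + δ + ε_F′ ≥ Δ + ε_F`, `t_pd² − t_pp′ε_F′ ≥ t_pd² − t_pp′ε_F`) and `N` does not increase (`ε_F′ ≤ ε_F`, `t_pp² ≥ t_pp′²`).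
* §3 BOX FORM (`fsRatio_fermiEnergyOf_mem_Icc_of_Delta_mem`): on a typed box whose only width is `Δ ∈ [Δ₁, Δ₂]`, the fixed-doping `t′/t` of every
  member lies between the two ENDPOINT values — a two-corner rule for object E in the Δ direction (the census at `Δ₁`, `Δ₂` bounds the box).

Sources: three-band model [HybertsenSchluterChristensen1989, Eq. (1)]; contour form [AndersenEtAl1995, §6]; arithmetic [folklore].
-/

noncomputable section

namespace Summit.Ventures.CertifiedManyBodySolver.Downfold.Emery

open Real Set

/-! ## §1 The shape is monotone in (D ↑, N ↓) -/

/-- `−N/(D + 2N) ≤ −N′/(D′ + 2N′)` when `0 < N′ ≤ N` and `0 ≤ D ≤ D′`. [folklore] -/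
theorem negRatio_mono {N N' D D' : ℝ} (hN' : 0 < N') (hNN : N' ≤ N) (hD : 0 ≤ D) (hDD : D ≤ D') :
    -N / (D + 2 * N) ≤ -N' / (D' + 2 * N') := by
  have hN : 0 < N := lt_of_lt_of_le hN' hNN
  have h1 : 0 < D + 2 * N := by linarith
  have h2 : 0 < D' + 2 * N' := by linarith
  rw [neg_div, neg_div, neg_le_neg_iff, div_le_div_iff₀ h2 h1]
  nlinarith [mul_nonneg hD (sub_nonneg.mpr hNN), mul_nonneg (sub_nonneg.mpr hDD) hN'.le]

/-! ## §2 The lever -/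

section Lever

variable {Δ a b c δ ν : ℝ}

/-- **AT FIXED DOPING, RAISING Δ MAKES THE FERMI-SURFACE `t′/t` LESS NEGATIVE.** [folklore] -/
theorem fsRatio_fermiEnergyOf_mono_Delta (hΔ : 0 < Δ) (ha : a ≠ 0) (hb : 0 < b) (hc : 0 ≤ c) (hcb : c ≤ b) (hδ : 0 ≤ δ)
    (hν0 : 0 < ν) (hν1 : ν < 1) (hex : ∃ ε : ℝ, abFilling Δ a b c ε = ν) (hex' : ∃ ε : ℝ, abFilling (Δ + δ) a b c ε = ν)
    (hreg : c * fermiEnergyOf Δ a b c ν ≤ a ^ 2) :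
    fsRatio Δ a b c (fermiEnergyOf Δ a b c ν) ≤ fsRatio (Δ + δ) a b c (fermiEnergyOf (Δ + δ) a b c ν) := by
  set e := fermiEnergyOf Δ a b c ν with he
  set e' := fermiEnergyOf (Δ + δ) a b c ν with he'
  have hup : e' ≤ e := fermiEnergyOf_shift_le hΔ ha hc hb.le hδ hν0 hν1 hex hex'
  have hlo : e - δ ≤ e' := fermiEnergyOf_sub_le_shift hΔ.le hc hb.le hδ hν0 hν1 hex hex'
  have he0 : 0 ≤ e := fermiEnergyOf_nonneg hΔ.le hc hb.le hν0 hν1 hex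
  have he'0 : 0 ≤ e' := fermiEnergyOf_nonneg (by linarith) hc hb.le hν0 hν1 hex'
  have ha2 : 0 < a ^ 2 := by positivity
  -- N' ≤ N, N' > 0
  have hN' : 0 < fsN a b c e' := by
    unfold fsN
    have : 0 ≤ b ^ 2 - c ^ 2 := by nlinarith
    have : 0 < 2 * a ^ 2 * (c + b) := by positivity
    nlinarith
  have hNN : fsN a b c e' ≤ fsN a b c e := by
    unfold fsN
    have : 0 ≤ b ^ 2 - c ^ 2 := by nlinarith
    nlinarith
  -- 0 ≤ D ≤ D'
  have hD : 0 ≤ fsD Δ a c e := by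
    unfold fsD
    exact mul_nonneg (by linarith) (by linarith)
  have hDD : fsD Δ a c e ≤ fsD (Δ + δ) a c e' := by
    unfold fsD
    have h1 : Δ + e ≤ Δ + δ + e' := by linarith
    have h2 : a ^ 2 - c * e ≤ a ^ 2 - c * e' := by nlinarith
    have h3 : 0 ≤ Δ + e := by linarith
    have h4 : 0 ≤ a ^ 2 - c * e := by linarith
    calc (Δ + e) * (a ^ 2 - c * e) ≤ (Δ + δ + e') * (a ^ 2 - c * e) := mul_le_mul_of_nonneg_right h1 h4
      _ ≤ (Δ + δ + e') * (a ^ 2 - c * e') := mul_le_mul_of_nonneg_left h2 (by linarith)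
  unfold fsRatio
  exact negRatio_mono hN' hNN hD hDD

/-! ## §3 Box form: the Δ-endpoints bound the fixed-doping shape -/

/-- **TWO-CORNER RULE IN Δ FOR OBJECT E**: for `Δ₁ ≤ Δ ≤ Δ₂` (all else fixed, the filling attained at the three rows, sheet regime at `Δ₁`
and `Δ`), the fixed-doping `t′/t` at `Δ` lies between its values at `Δ₁` and `Δ₂`. [folklore] -/
theorem fsRatio_fermiEnergyOf_mem_Icc_of_Delta_mem {Δ₁ Δ₂ : ℝ} (hΔ₁ : 0 < Δ₁) (h12 : Δ₁ ≤ Δ) (h2 : Δ ≤ Δ₂) (ha : a ≠ 0) (hb : 0 < b)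
    (hc : 0 ≤ c) (hcb : c ≤ b) (hν0 : 0 < ν) (hν1 : ν < 1)
    (hex₁ : ∃ ε : ℝ, abFilling Δ₁ a b c ε = ν) (hex : ∃ ε : ℝ, abFilling Δ a b c ε = ν) (hex₂ : ∃ ε : ℝ, abFilling Δ₂ a b c ε = ν)
    (hreg₁ : c * fermiEnergyOf Δ₁ a b c ν ≤ a ^ 2) (hreg : c * fermiEnergyOf Δ a b c ν ≤ a ^ 2) :
    fsRatio Δ a b c (fermiEnergyOf Δ a b c ν) ∈
      Icc (fsRatio Δ₁ a b c (fermiEnergyOf Δ₁ a b c ν)) (fsRatio Δ₂ a b c (fermiEnergyOf Δ₂ a b c ν)) := by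
  constructor
  · have h := fsRatio_fermiEnergyOf_mono_Delta (δ := Δ - Δ₁) hΔ₁ ha hb hc hcb (by linarith) hν0 hν1 hex₁
      (by rw [show Δ₁ + (Δ - Δ₁) = Δ by ring]; exact hex) hreg₁
    rw [show Δ₁ + (Δ - Δ₁) = Δ by ring] at h
    exact h
  · have h := fsRatio_fermiEnergyOf_mono_Delta (δ := Δ₂ - Δ) (lt_of_lt_of_le hΔ₁ h12) ha hb hc hcb (by linarith) hν0 hν1 hex
      (by rw [show Δ + (Δ₂ - Δ) = Δ₂ by ring]; exact hex₂) hreg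
    rw [show Δ + (Δ₂ - Δ) = Δ₂ by ring] at h
    exact h

end Lever

end Summit.Ventures.CertifiedManyBodySolver.Downfold.Emery
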